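/-
COR-CM (cell pub-hodgecm2, stage 2 of the Hodge ladder) — count-neutral KERNEL COMBINATORICS «field level: every Galois CM field of degree 4pᵏ cyclic over a
quadratic subfield has EXACTLY φ₂(F) generating faces» (seat prover-pub-hodgecm2-b23-g50-0, binder prover b23, gen 50; own census lane INDEX-TWO CYCLIC
2-GROUPS, extension «SMALL DEGREES», claim HOME/INBOX.md l.23042, INTERIM #1 l.23124).  Theorems only; `Census/IndexTwoCyclicOddPrimePower.lean` (this seat),
the field transfer and the INT2-GEN socket are used BY NAME; nothing asserted.  `Interfaces.lean` (C1), every E term, B01, `Transposition/*`, `PortJoin/*`,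
`D2Bridge/*` untouched.
HONEST FRAMING: `HC_CM` is NOT proved, here or anywhere in the tree; this file produces no period and proves no face period for any field; §2 is
CONDITIONAL on the face periods exactly as the earlier sockets.
T5: n/a-class (hypothesis binders: `[F:ℚ] = 4pᵏ`, `p` odd prime, `k ≠ 0`, an index-two cyclic subgroup of `GalT F` / `Aut F` / a quadratic subfield with
cyclic fixing group — inhabited by `ℚ(ζ₉, i)`; checker: self, 2026-08-25).
-/
import Summits.HodgeConjecture.CorCM.Census.IndexTwoCyclicOddPrimePower
import Summits.HodgeConjecture.CorCM.FaceIndexTwoCyclicSmallDegrees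
import HarnessLib

/-!
# Field level: Galois CM fields of degree `4pᵏ` that are cyclic over a quadratic subfield

A Galois CM field `F` of degree `4pᵏ` (`p` an odd prime, `k ≥ 1`) whose Galois group has a cyclic subgroup of index two — equivalently `F` is cyclic
over some quadratic subfield `E`, equivalently (Cauchy) `Gal(F/ℚ)` has a cyclic Sylow `p`-subgroup — has group `ℤ/4pᵏ`, `ℤ/2pᵏ × ℤ/2`, `D_{4pᵏ}` or
`Q_{4pᵏ}`, complex conjugation any central involution.  By `Census/IndexTwoCyclicOddPrimePower.lean` §4 (seat b23 gen 50) its face census closes: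

* §1 **`isLeast_card_faces_hgen_of_finrank_eq_four_mul_prime_pow (hp) (hp2) (hk) (hdeg : [F:ℚ] = 4pᵏ) (u : GalT F) (hindex) (σ₀)`**, `…_of_aut_…` (from
  `u₀ ∈ Aut F`), **`…_of_cyclic_over_quadratic_odd_prime_pow (E : IntermediateField ℚ F) (hE : [E:ℚ] = 2) (hcyc : IsCyclic E.fixingSubgroup)`**: EXACTLY
  `φ₂(F)` generating faces.  With `CorCM/FaceIndexTwoCyclicTwoGroups.lean` (degree `2ᵏ`) and gen 40ʼs odd half-degree law (degree `2m`, `m` odd) this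
  settles every Galois CM field cyclic over a quadratic subfield whose degree is `2ᵏ`, `4pᵏ` or `2m`.
* §2 the CONDITIONAL Hodge-conjecture reading through the INT2-GEN socket.  `HC_CM` is NOT proved.

## References
* [Pohlmann1968] H. Pohlmann, Algebraic cycles on abelian varieties of complex multiplication type, Ann. of Math. 88 (1968), Thm 1.
* [Shimura1998] G. Shimura, Abelian Varieties with Complex Multiplication and Modular Functions, §6.2 Thm. 3, §8.1.
-/

noncomputable section

open CategoryTheory NumberField NumberField.ComplexEmbedding
open Literature.AlgebraicGeometry Literature.AlgebraicGeometry.Motives Literature.AlgebraicGeometry.HodgeTheory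
open Literature.AlgebraicGeometry.ComplexMultiplication Literature.AlgebraicGeometry.Milne1999
open Literature.NumberTheory.Automorphic
open Literature.NumberTheory.Automorphic.PicardCM
open Summit.HodgeConjecture.CorCM.Domination

namespace Summit.HodgeConjecture.CorCM.FaceIndexTwoCyclic

open Summit.HodgeConjecture.CorCM.Prior.AllgGroup.RfwfAllgGroup
open Summit.HodgeConjecture.CorCM.Census.BlockParity
open Summit.HodgeConjecture.CorCM.Census.Coinvariant
open Summit.HodgeConjecture.CorCM.Census
open Summit.HodgeConjecture.CorCM.FaceCensus.OddSlice (galTOfAut galTOfAut_mul galTOfAut_conjAut)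

section Field

variable {F : Type} [Field F] [NumberField F]

/-! ## §1 Exactly `φ₂(F)` generating faces -/

/-- **EVERY GALOIS CM FIELD OF DEGREE `4pᵏ` WHOSE GALOIS TRANSLATES HAVE A CYCLIC SUBGROUP OF INDEX TWO HAS EXACTLY `φ₂(F)` GENERATING FACES.** [folklore] -/
theorem isLeast_card_faces_hgen_of_finrank_eq_four_mul_prime_pow [IsCMField F] [IsGalois ℚ F] {p k : ℕ} (hp : p.Prime) (hp2 : p ≠ 2) (hk : k ≠ 0)
    (hdeg : Module.finrank ℚ F = 4 * p ^ k) (u : GalT F) (hindex : (Subgroup.zpowers u).index = 2) (σ₀ : F →+* ℂ) :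
    IsLeast {m : ℕ | ∃ 𝒮 : Finset (Face F), 𝒮.card = m ∧
      ∀ f : Face F, lefChar f.corner (fun _ => ({σ₀} : Finset (F →+* ℂ))) ∈ AddSubgroup.closure
        {a : Asym F | ∃ g ∈ (𝒮 : Set (Face F)), ∃ σ : F →+* ℂ, a = lefChar g.corner (fun _ => ({σ} : Finset (F →+* ℂ)))}}
      (fibreTwo (conjT : GalT F) conjT_mul_self) := by
  have hcard : Fintype.card (GalT F) = 4 * p ^ k := (FaceCensus.card_galT (F := F)).trans hdeg
  refine FaceTransfer.isLeast_card_faces_hgen_of_intrinsic _ ?_ (fun S₀ hS₀ hS => ?_) σ₀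
  · obtain ⟨S, hS, hcard', hgen⟩ := (IndexTwoCyclic.isLeast_card_gfaces_generate_fibreTwo_of_card_eq_four_mul_prime_pow_of_index_two
      conjT_mul_self conjT_ne_one FaceBasis.conjT_comm hp hp2 hk hcard u hindex).1
    exact ⟨S, hS, hcard'.le, hgen⟩
  · exact fibreTwo_le_card conjT conjT_mul_self FaceBasis.conjT_comm S₀ (Submodule.span ℤ (pairSet conjT)) le_rfl hS₀
      (fun y hy => hS (gfaceSet_subset_hodgeSpan conjT conjT_mul_self hy))

/-- **… from an automorphism `u₀ ∈ Aut(F)` generating a subgroup of index two.** [folklore] -/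
theorem isLeast_card_faces_hgen_of_aut_four_mul_prime_pow [IsCMField F] [IsGalois ℚ F] (σ₀ : F →+* ℂ) {p k : ℕ} (hp : p.Prime) (hp2 : p ≠ 2)
    (hk : k ≠ 0) (hdeg : Module.finrank ℚ F = 4 * p ^ k) (u₀ : F ≃ₐ[ℚ] F) (hindex : (Subgroup.zpowers u₀).index = 2) :
    IsLeast {m : ℕ | ∃ 𝒮 : Finset (Face F), 𝒮.card = m ∧
      ∀ f : Face F, lefChar f.corner (fun _ => ({σ₀} : Finset (F →+* ℂ))) ∈ AddSubgroup.closure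
        {a : Asym F | ∃ g ∈ (𝒮 : Set (Face F)), ∃ σ : F →+* ℂ, a = lefChar g.corner (fun _ => ({σ} : Finset (F →+* ℂ)))}}
      (fibreTwo (conjT : GalT F) conjT_mul_self) := by
  set e : (F ≃ₐ[ℚ] F) ≃* GalT F := MulEquiv.mk' (galTOfAut σ₀) (galTOfAut_mul σ₀) with he
  have hidx : (Subgroup.zpowers (e u₀)).index = 2 := by
    rw [← MonoidHom.coe_coe, ← MonoidHom.map_zpowers, Subgroup.index_map_equiv, hindex]
  exact isLeast_card_faces_hgen_of_finrank_eq_four_mul_prime_pow hp hp2 hk hdeg (e u₀) hidx σ₀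

/-- **EVERY GALOIS CM FIELD OF DEGREE `4pᵏ` THAT IS CYCLIC OVER A QUADRATIC SUBFIELD HAS EXACTLY `φ₂(F)` GENERATING FACES**: `E ⊆ F` with `[E:ℚ] = 2`
(real or imaginary) and `Gal(F/E)` cyclic. [folklore] -/
theorem isLeast_card_faces_hgen_of_cyclic_over_quadratic_four_mul_prime_pow [IsCMField F] [IsGalois ℚ F] (σ₀ : F →+* ℂ) {p k : ℕ}
    (hp : p.Prime) (hp2 : p ≠ 2) (hk : k ≠ 0) (hdeg : Module.finrank ℚ F = 4 * p ^ k) (E : IntermediateField ℚ F)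
    (hE : Module.finrank ℚ E = 2) (hcyc : IsCyclic E.fixingSubgroup) :
    IsLeast {m : ℕ | ∃ 𝒮 : Finset (Face F), 𝒮.card = m ∧
      ∀ f : Face F, lefChar f.corner (fun _ => ({σ₀} : Finset (F →+* ℂ))) ∈ AddSubgroup.closure
        {a : Asym F | ∃ g ∈ (𝒮 : Set (Face F)), ∃ σ : F →+* ℂ, a = lefChar g.corner (fun _ => ({σ} : Finset (F →+* ℂ)))}}
      (fibreTwo (conjT : GalT F) conjT_mul_self) := by
  obtain ⟨g, hg⟩ := IsCyclic.exists_generator (α := E.fixingSubgroup)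
  have hzp : Subgroup.zpowers (g : F ≃ₐ[ℚ] F) = E.fixingSubgroup := by
    apply le_antisymm (Subgroup.zpowers_le.mpr g.2)
    intro x hx
    obtain ⟨m, hm⟩ := Subgroup.mem_zpowers_iff.mp (hg ⟨x, hx⟩)
    exact Subgroup.mem_zpowers_iff.mpr ⟨m, by rw [← Subgroup.coe_zpow, hm]⟩
  have hindex : (Subgroup.zpowers (g : F ≃ₐ[ℚ] F)).index = 2 := by
    rw [hzp]
    exact FaceAbelian.index_fixingSubgroup_eq_two E hE
  exact isLeast_card_faces_hgen_of_aut_four_mul_prime_pow σ₀ hp hp2 hk hdeg g hindex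

end Field

/-! ## §2 The Hodge-conjecture reading through the INT2-GEN socket (conditional on the face periods) -/

/-- **HC for the slice of a Galois CM field of degree `4pᵏ` cyclic over a quadratic subfield, from `φ₂(K)` face periods** (INT2-GEN socket BY NAME;
CONDITIONAL on the periods — `HC_CM` is NOT proved). [cite: Shimura1998, §6.2 Theorem 3 and §6.1 Corollary of Theorem 2 (pp. 41–43)]
[cite: Pohlmann1968, Thm. 1] [cite: Milne1999LefschetzClasses, Thm. 3.2 and Cor. 4.5] [cite: MumfordAV1970, §19 Thm. 1 and p. 169] -/
theorem hodgeConjectureFor_of_cyclic_over_quadratic_four_mul_prime_pow_of_exists_facePeriod (K : CMField) [hGal : IsGalois ℚ K] {p k : ℕ}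
    (hp : p.Prime) (hp2 : p ≠ 2) (hk : k ≠ 0) (hdeg : Module.finrank ℚ K = 4 * p ^ k) (E : IntermediateField ℚ K)
    (hE : Module.finrank ℚ E = 2) (hcyc : IsCyclic E.fixingSubgroup) (σ₀ : (K : Type) →+* ℂ) :
    ∃ 𝒮 : Finset (Face K), 𝒮.card = fibreTwo (conjT : GalT K) conjT_mul_self ∧
      ((∀ f ∈ 𝒮, ∃ ι₁ : K →+* ℂ, f.Admissible ι₁ ∧ ∃ (V : HermSpace3 K ι₁) (σ : K →+* ℂ),
        (Model.picardCMUniverse exists_isReal_hodgeModel_holds hodgePQ_independent_of_hodgeModel_holds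
          BallQuotient.ballQuotientUniformised_holds cmAbelianVarietyRealised_holds).PeriodNV ι₁ V K f.psi σ) →
      ∀ {P B : AbelianVariety ℂ}, AbelianVariety.IsProductOf (fun B : AbelianVariety ℂ =>
        ∃ (E : Type) (_ : Field E) (_ : NumberField E) (_ : IsCMField E) (_ : E →+* (K : Type)) (Φ : CMType E)
          (ι : 𝓞 E →+* End B) (ϑ : E →+* Module.End ℂ (complexBetti B.X 1)),
          IsCMTypeRealisation Φ B ι ϑ) P →
      AVDominatedBy B P → HodgeConjectureFor B.dim B.X) := by
  obtain ⟨⟨𝒮, hcard, hgen⟩, -⟩ := isLeast_card_faces_hgen_of_cyclic_over_quadratic_four_mul_prime_pow (F := K) σ₀ hp hp2 hk hdeg E hE hcyc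
  refine ⟨𝒮, hcard, fun h P B hP hB => ?_⟩
  have h6 : 6 ≤ Module.finrank ℚ K := by
    rw [hdeg]
    have h3 : 3 ≤ p ^ k := le_trans (by have := hp.two_le; omega) (Nat.le_self_pow hk p)
    omega
  exact hodgeConjectureFor_of_avDominatedBy_isProductOf_of_exists_facePeriod_on K h6 (𝒮 : Set (Face K)) σ₀ hgen
    (fun f hf => h f (Finset.mem_coe.mp hf)) hP hB

end Summit.HodgeConjecture.CorCM.FaceIndexTwoCyclic
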